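import Summits.SmoothPoincare4.SmoothPoincare4.Theses.SymplecticOrigami
import Summits.SmoothPoincare4.SmoothPoincare4.Theorems.SymplecticOrigamiOrigamiRungStubBallFunctionChart
import Mathlib.Analysis.Calculus.Deriv.Slope

/-!
# Stub `stub_pinch_sepFun` of line `pair-rigidity-endgame`, part 1: local and calculus lemmas

Helpers for the separating regular function of the fold (crux `SymplecticOrigami.OrigamiRung`,
file `SymplecticOrigamiOrigamiRungStubPinchSepFun.lean`), the manifold-ambient version of the
partition-of-unity argument of the tree's
`Literature.Topology.FourManifolds.exists_definingFunction_of_sides` (Akbulut–King, proof of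
Thm. 2.8.2, Assertion 2.8.2.1):

* `exists_sign_of_local_halves` — point-set step: a local coordinate `t` near a point `p` of the
  splitting set `K = (A ⊔ B)ᶜ`, vanishing exactly on `K` in its domain `O`, whose two open halves
  `{t > 0}`, `{t < 0}` are preconnected, can be sign-normalised so that `σ t > 0 ⇔ B` and
  `σ t < 0 ⇔ A` on `O ∖ K` (each half lies in `A` or in `B`; `p` adheres to both `A` and `B`);
* `exists_local_sepFun` — at each point of a smoothly embedded hypersurface `f : S → X`
  (`X` modelled on `ℝⁿ⁺¹`) with such a splitting of `(range f)ᶜ`, the slice box of the landed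
  `exists_slice_box` gives an open `O`, a function `ψ` smooth on `O` with
  `O ∩ range f = O ∩ ψ⁻¹(0)`, the sign property above, and through every point of
  `O ∩ range f` a curve `γ`, smooth at `0`, with `ψ (γ s) = s` near `0` (the coordinate line of
  the box);
* `exists_pos_hasDerivAt_sum` — calculus step: for a finite family of products `w i * G i` of
  real functions differentiable at `0` with `G i 0 = 0`, `w i 0 ≥ 0`, all slopes `G i s / s ≥ 0`
  near `0`, and one index with `w i₁ 0 > 0` and `G i₁ = id` near `0`, the sum has POSITIVE
  derivative at `0`;
* `mfderiv_ne_zero_of_hasDerivAt_comp` — a function whose restriction to a smooth curve through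
  `x` has non-zero derivative at the parameter of `x` has `mfderiv ≠ 0` at `x` (chain rule);
* `stub_pinch_sepFun_local` — the universe-monomorphic export of `exists_local_sepFun` (the
  registered sub-goal of this file).

All folklore.
-/

noncomputable section

-- the prescribed namespace `Summit.<P>.<Sub>.…` duplicates `SmoothPoincare4` (P = Sub)
set_option linter.dupNamespace false

open scoped Manifold ContDiff Topology
open Set Filter

namespace Summit.SmoothPoincare4.SmoothPoincare4.Theorems.OrigamiRung.PairRigidityEndgame

/-! ### Point-set step: sign-normalising a local coordinate -/

section Sign

variable {X : Type*} [TopologicalSpace X]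

/-- **Sign normalisation of a local coordinate across a splitting set.**  Let `A, B ⊆ X` be
disjoint open sets, `K = (A ∪ B)ᶜ`, `O` an open neighbourhood of a point `p` adherent to both `A`
and `B`, and `t : X → ℝ` a function with `O ∩ K = O ∩ t⁻¹(0)` whose two open halves
`{x ∈ O | t x > 0}`, `{x ∈ O | t x < 0}` are preconnected.  Then for `σ = 1` or `σ = -1`, off
`K` in `O` one has `σ t > 0 ⇔ B` and `σ t < 0 ⇔ A`.  (Each half lies in `A ⊔ B`, hence in `A`
or in `B`; a point of `O ∩ B` and a point of `O ∩ A` exist and each lies in one of the halves,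
so the halves are not both in `A` nor both in `B`.) [folklore] -/
theorem exists_sign_of_local_halves {A B K O : Set X} {t : X → ℝ} (hA : IsOpen A)
    (hB : IsOpen B) (hAB : Disjoint A B) (hK : K = (A ∪ B)ᶜ) (hO : IsOpen O) {p : X}
    (hpO : p ∈ O) (hpA : p ∈ closure A) (hpB : p ∈ closure B)
    (ht : ∀ x ∈ O, x ∈ K ↔ t x = 0) (hpos : IsPreconnected {x | x ∈ O ∧ 0 < t x})
    (hneg : IsPreconnected {x | x ∈ O ∧ t x < 0}) :
    ∃ σ : ℝ, (σ = 1 ∨ σ = -1) ∧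
      ∀ x ∈ O, x ∉ K → ((0 < σ * t x ↔ x ∈ B) ∧ (σ * t x < 0 ↔ x ∈ A)) := by
  have hAB' : ∀ {x}, x ∈ A → x ∉ B := fun hx hx' => disjoint_left.1 hAB hx hx'
  have hKout : ∀ {x}, x ∈ O → t x ≠ 0 → x ∈ A ∪ B := fun {x} hxO hx0 => by
    have hxK : x ∉ K := fun hxK => hx0 ((ht x hxO).1 hxK)
    rwa [hK, mem_compl_iff, not_not] at hxK
  have hposAB := hpos.subset_or_subset hA hB hAB fun x hx => hKout hx.1 hx.2.ne'
  have hnegAB := hneg.subset_or_subset hA hB hAB fun x hx => hKout hx.1 hx.2.ne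
  -- a point of `O ∩ C` off `K`, for `C = A, B`
  have hmeet : ∀ {C : Set X}, p ∈ closure C → C ⊆ A ∪ B → ∃ c ∈ C, c ∈ O ∧ t c ≠ 0 := by
    intro C hpC hC
    obtain ⟨c, hcO, hcC⟩ := mem_closure_iff.1 hpC O hO hpO
    refine ⟨c, hcC, hcO, fun h0 => ?_⟩
    have hcK : c ∈ K := (ht c hcO).2 h0
    rw [hK] at hcK
    exact hcK (hC hcC)
  obtain ⟨b, hbB, hbO, hb0⟩ := hmeet hpB subset_union_right
  obtain ⟨a, haA, haO, ha0⟩ := hmeet hpA subset_union_left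
  have key : ({x | x ∈ O ∧ 0 < t x} ⊆ B ∧ {x | x ∈ O ∧ t x < 0} ⊆ A) ∨
      ({x | x ∈ O ∧ 0 < t x} ⊆ A ∧ {x | x ∈ O ∧ t x < 0} ⊆ B) := by
    rcases hposAB with hP | hP <;> rcases hnegAB with hN | hN
    · rcases hb0.lt_or_gt with h | h
      · exact absurd hbB (hAB' (hN ⟨hbO, h⟩))
      · exact absurd hbB (hAB' (hP ⟨hbO, h⟩))
    · exact Or.inr ⟨hP, hN⟩
    · exact Or.inl ⟨hP, hN⟩
    · rcases ha0.lt_or_gt with h | h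
      · exact absurd (hN ⟨haO, h⟩) (hAB' haA)
      · exact absurd (hP ⟨haO, h⟩) (hAB' haA)
  rcases key with ⟨hP, hN⟩ | ⟨hP, hN⟩
  · refine ⟨1, Or.inl rfl, fun x hxO hxK => ?_⟩
    have hx0 : t x ≠ 0 := fun h => hxK ((ht x hxO).2 h)
    rw [one_mul]
    rcases hx0.lt_or_gt with h | h
    · have hxA : x ∈ A := hN ⟨hxO, h⟩
      exact ⟨iff_of_false (not_lt.2 h.le) (hAB' hxA), iff_of_true h hxA⟩
    · have hxB : x ∈ B := hP ⟨hxO, h⟩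
      exact ⟨iff_of_true h hxB, iff_of_false (not_lt.2 h.le) fun hxA => hAB' hxA hxB⟩
  · refine ⟨-1, Or.inr rfl, fun x hxO hxK => ?_⟩
    have hx0 : t x ≠ 0 := fun h => hxK ((ht x hxO).2 h)
    rw [neg_one_mul]
    rcases hx0.lt_or_gt with h | h
    · have hxB : x ∈ B := hN ⟨hxO, h⟩
      exact ⟨iff_of_true (neg_pos.2 h) hxB,
        iff_of_false (not_lt.2 (neg_pos.2 h).le) fun hxA => hAB' hxA hxB⟩
    · have hxA : x ∈ A := hP ⟨hxO, h⟩
      exact ⟨iff_of_false (not_lt.2 (neg_nonpos.2 h.le)) (hAB' hxA),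
        iff_of_true (neg_neg_of_pos h) hxA⟩

end Sign

/-! ### Local step: a sign-normalised slice coordinate and its coordinate line -/

section LocalSepFun

variable {n : ℕ} {S : Type*} [TopologicalSpace S] [ChartedSpace (EuclideanSpace ℝ (Fin n)) S]
  {X : Type*} [TopologicalSpace X] [ChartedSpace (EuclideanSpace ℝ (Fin (n + 1))) X] {f : S → X}

/-- **Local separating coordinate of a two-sided embedded hypersurface.**  Let `f : S → X` be a
smooth embedding of an `n`-manifold into an `(n+1)`-manifold, `A ⊔ B = (range f)ᶜ` a splitting
into disjoint open sets with `range f ⊆ closure A ∩ closure B`, and `z₀ ∈ S`.  There are an open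
`O ∋ f z₀` and `ψ : X → ℝ` smooth on `O` with `O ∩ range f = O ∩ ψ⁻¹(0)`, `ψ > 0 ⇔ B` and
`ψ < 0 ⇔ A` on `O ∖ range f`, and through every point `x ∈ O ∩ range f` a curve `γ`, smooth at
`0`, with `γ 0 = x` and `ψ (γ s) = s` for `s` near `0`.  (`ψ` is the sign-normalised last
coordinate of the slice box `exists_slice_box`, whose open halves are images of convex half-balls;
`γ` is the coordinate line of the box through `x`.)
[cite: LeeSmoothManifolds2013, Thm. 5.8 and Prop. 5.2] -/
theorem exists_local_sepFun (hf : Manifold.IsSmoothEmbedding (𝓡 n) (𝓡 (n + 1)) ∞ f)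
    {A B : Set X} (hA : IsOpen A) (hB : IsOpen B) (hAB : Disjoint A B)
    (hK : range f = (A ∪ B)ᶜ) (hclA : range f ⊆ closure A) (hclB : range f ⊆ closure B)
    (z₀ : S) :
    ∃ (O : Set X) (ψ : X → ℝ), IsOpen O ∧ f z₀ ∈ O ∧ ContMDiffOn (𝓡 (n + 1)) 𝓘(ℝ, ℝ) ∞ ψ O ∧
      (∀ x ∈ O, x ∈ range f ↔ ψ x = 0) ∧
      (∀ x ∈ O, x ∉ range f → ((0 < ψ x ↔ x ∈ B) ∧ (ψ x < 0 ↔ x ∈ A))) ∧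
      ∀ x ∈ O, x ∈ range f → ∃ γ : ℝ → X, γ 0 = x ∧
        ContMDiffAt 𝓘(ℝ, ℝ) (𝓡 (n + 1)) ∞ γ 0 ∧ ∀ᶠ s in 𝓝 0, γ s ∈ O ∧ ψ (γ s) = s := by
  obtain ⟨φ, T, r, hr, hφ, hz₀φ, -, hTsymm, hslice⟩ := exists_slice_box hf z₀
  set c : (EuclideanSpace ℝ (Fin n)) × ℝ := T (φ (f z₀))
  set O : Set X := {x | x ∈ φ.source ∧ T (φ x) ∈ Metric.ball c r}
  set t : X → ℝ := fun x => (T (φ x)).2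
  have hOo : IsOpen O :=
    (T.continuous.comp_continuousOn φ.continuousOn).isOpen_inter_preimage φ.open_source
      Metric.isOpen_ball
  have hz₀O : f z₀ ∈ O := ⟨hz₀φ, Metric.mem_ball_self hr⟩
  -- smoothness of the chart, its inverse, and the coordinate `t`
  have hφs : ContMDiffOn (𝓡 (n + 1)) (𝓡 (n + 1)) ∞ φ φ.source := contMDiffOn_of_mem_maximalAtlas hφ
  have hφs' : ContMDiffOn (𝓡 (n + 1)) (𝓡 (n + 1)) ∞ φ.symm φ.target :=
    contMDiffOn_symm_of_mem_maximalAtlas hφ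
  set L : (EuclideanSpace ℝ (Fin (n + 1))) →L[ℝ] ℝ :=
    (ContinuousLinearMap.snd ℝ (EuclideanSpace ℝ (Fin n)) ℝ).comp
      (T : (EuclideanSpace ℝ (Fin (n + 1))) →L[ℝ] (EuclideanSpace ℝ (Fin n)) × ℝ)
  have hts : ContMDiffOn (𝓡 (n + 1)) 𝓘(ℝ, ℝ) ∞ t φ.source := L.contMDiff.comp_contMDiffOn hφs
  -- the box parametrisation `g`
  set g : (EuclideanSpace ℝ (Fin n)) × ℝ → X := fun q => φ.symm (T.symm q) with hg_def
  have hgc : ContinuousOn g (Metric.ball c r) :=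
    φ.continuousOn_symm.comp T.symm.continuous.continuousOn fun q hq => hTsymm q hq
  have hgx : ∀ x ∈ O, g (T (φ x)) = x := fun x hx => by
    simp only [hg_def, ContinuousLinearEquiv.symm_apply_apply, φ.left_inv hx.1]
  have hTg : ∀ q ∈ Metric.ball c r, T (φ (g q)) = q := fun q hq => by
    simp only [hg_def, φ.right_inv (hTsymm q hq), ContinuousLinearEquiv.apply_symm_apply]
  have hgO : ∀ q ∈ Metric.ball c r, g q ∈ O := fun q hq =>
    ⟨φ.map_target (hTsymm q hq), by rw [hTg q hq]; exact hq⟩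
  -- the halves are images of convex half-balls, hence preconnected
  have hpre : ∀ s : Set ℝ, Convex ℝ s → IsPreconnected {x | x ∈ O ∧ t x ∈ s} := by
    intro s hs
    have himage : {x | x ∈ O ∧ t x ∈ s} = g '' (Metric.ball c r ∩ Prod.snd ⁻¹' s) := by
      ext x
      constructor
      · rintro ⟨hxO, hxs⟩
        exact ⟨T (φ x), ⟨hxO.2, hxs⟩, hgx x hxO⟩
      · rintro ⟨q, ⟨hq, hqs⟩, rfl⟩
        refine ⟨hgO q hq, ?_⟩
        show (T (φ (g q))).2 ∈ s
        rw [hTg q hq]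
        exact hqs
    rw [himage]
    exact ((convex_ball _ _).inter (hs.linear_preimage (LinearMap.snd ℝ _ ℝ))).isPreconnected.image
      _ (hgc.mono inter_subset_left)
  -- sign normalisation
  have htK : ∀ x ∈ O, x ∈ range f ↔ t x = 0 := fun x hx => hslice x hx.1 hx.2
  obtain ⟨σ, hσ, hsign⟩ := exists_sign_of_local_halves hA hB hAB hK hOo hz₀O (hclA ⟨z₀, rfl⟩)
    (hclB ⟨z₀, rfl⟩) htK (hpre (Ioi 0) (convex_Ioi 0)) (hpre (Iio 0) (convex_Iio 0))
  have hσ0 : σ ≠ 0 := by rcases hσ with rfl | rfl <;> norm_num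
  have hσσ : σ * σ = 1 := by rcases hσ with rfl | rfl <;> norm_num
  refine ⟨O, fun x => σ * t x, hOo, hz₀O, contMDiffOn_const.mul (hts.mono fun x hx => hx.1),
    fun x hx => ?_, hsign, fun x hxO hxK => ?_⟩
  · rw [htK x hx, mul_eq_zero, or_iff_right hσ0]
  -- the coordinate line through `x ∈ O ∩ range f`
  have hx2 : (T (φ x)).2 = 0 := (htK x hxO).1 hxK
  set a : EuclideanSpace ℝ (Fin n) := (T (φ x)).1
  have hTx : T (φ x) = (a, 0) := Prod.ext rfl hx2
  set w : ℝ → EuclideanSpace ℝ (Fin (n + 1)) := fun s => T.symm (a, σ * s) with hw_def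
  have hwc : ContDiff ℝ ∞ w :=
    T.symm.contDiff.comp (contDiff_const.prodMk (contDiff_const.mul contDiff_id))
  have hw0 : w 0 = φ x := by
    simp only [hw_def, mul_zero, ← hTx, ContinuousLinearEquiv.symm_apply_apply]
  refine ⟨fun s => g (a, σ * s), ?_, ?_, ?_⟩
  · show φ.symm (w 0) = x
    rw [hw0, φ.left_inv hxO.1]
  · show ContMDiffAt 𝓘(ℝ, ℝ) (𝓡 (n + 1)) ∞ (φ.symm ∘ w) 0
    exact (hφs'.contMDiffAt (φ.open_target.mem_nhds (hw0 ▸ φ.map_source hxO.1))).comp 0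
      hwc.contMDiff.contMDiffAt
  · have hlin : Continuous fun s : ℝ => ((a, σ * s) : (EuclideanSpace ℝ (Fin n)) × ℝ) :=
      continuous_const.prodMk (continuous_const.mul continuous_id)
    have hmem : ∀ᶠ s in 𝓝 (0 : ℝ),
        ((a, σ * s) : (EuclideanSpace ℝ (Fin n)) × ℝ) ∈ Metric.ball c r := by
      refine hlin.continuousAt.preimage_mem_nhds (Metric.isOpen_ball.mem_nhds ?_)
      rw [mul_zero, ← hTx]
      exact hxO.2
    filter_upwards [hmem] with s hs
    refine ⟨hgO _ hs, ?_⟩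
    show σ * (T (φ (g (a, σ * s)))).2 = s
    rw [hTg _ hs, ← mul_assoc, hσσ, one_mul]

end LocalSepFun

/-! ### Calculus step -/

/-- **Positive derivative of a glued sum.**  Let `w i, G i : ℝ → ℝ` (`i ∈ I`, finite) be
differentiable at `0` with `G i 0 = 0`, `0 ≤ w i 0`, and all slopes `s⁻¹ G i s ≥ 0` for `s ≠ 0`
near `0`; let `i₁ ∈ I` have `0 < w i₁ 0` and `G i₁ s = s` near `0`.  Then
`s ↦ ∑ i ∈ I, w i s * G i s` has a positive derivative at `0` (namely `∑ w i 0 · (G i)' 0`, each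
`(G i)' 0 ≥ 0` as a limit of non-negative slopes, and `(G i₁)' 0 = 1`). [folklore] -/
theorem exists_pos_hasDerivAt_sum {ι : Type*} (I : Finset ι) {w G : ι → ℝ → ℝ}
    (hw : ∀ i ∈ I, DifferentiableAt ℝ (w i) 0) (hG : ∀ i ∈ I, DifferentiableAt ℝ (G i) 0)
    (hG0 : ∀ i ∈ I, G i 0 = 0) (hw0 : ∀ i ∈ I, 0 ≤ w i 0)
    (hslope : ∀ i ∈ I, ∀ᶠ s in 𝓝[≠] (0 : ℝ), 0 ≤ s⁻¹ * G i s) {i₁ : ι} (hi₁ : i₁ ∈ I)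
    (hw₁ : 0 < w i₁ 0) (hG₁ : ∀ᶠ s in 𝓝 (0 : ℝ), G i₁ s = s) :
    ∃ D : ℝ, 0 < D ∧ HasDerivAt (fun s => ∑ i ∈ I, w i s * G i s) D 0 := by
  have hsum : HasDerivAt (fun s => ∑ i ∈ I, w i s * G i s)
      (∑ i ∈ I, (deriv (w i) 0 * G i 0 + w i 0 * deriv (G i) 0)) 0 :=
    HasDerivAt.fun_sum fun i hi => ((hw i hi).hasDerivAt.mul (hG i hi).hasDerivAt)
  refine ⟨_, ?_, hsum⟩
  have hterm : ∀ i ∈ I, deriv (w i) 0 * G i 0 + w i 0 * deriv (G i) 0 = w i 0 * deriv (G i) 0 :=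
    fun i hi => by rw [hG0 i hi, mul_zero, zero_add]
  rw [Finset.sum_congr rfl hterm]
  -- each `deriv (G i) 0 ≥ 0`
  have hnonneg : ∀ i ∈ I, 0 ≤ deriv (G i) 0 := by
    intro i hi
    have ht : Tendsto (slope (G i) 0) (𝓝[≠] 0) (𝓝 (deriv (G i) 0)) :=
      hasDerivAt_iff_tendsto_slope.1 (hG i hi).hasDerivAt
    refine ge_of_tendsto ht ?_
    filter_upwards [hslope i hi] with s hs
    rwa [slope_def_field, hG0 i hi, sub_zero, sub_zero, div_eq_inv_mul]
  -- and `deriv (G i₁) 0 = 1`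
  have hone : deriv (G i₁) 0 = 1 := by
    have h : HasDerivAt (G i₁) 1 0 :=
      (hasDerivAt_id (0 : ℝ)).congr_of_eventuallyEq (hG₁.mono fun s hs => hs)
    exact h.deriv
  calc 0 < w i₁ 0 * deriv (G i₁) 0 := by rw [hone, mul_one]; exact hw₁
    _ ≤ ∑ i ∈ I, w i 0 * deriv (G i) 0 :=
      Finset.single_le_sum (f := fun i => w i 0 * deriv (G i) 0)
        (fun i hi => mul_nonneg (hw0 i hi) (hnonneg i hi)) hi₁

/-! ### Chain-rule step -/

section ChainRule

variable {m : ℕ} {M : Type*} [TopologicalSpace M] [ChartedSpace (EuclideanSpace ℝ (Fin m)) M]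

/-- **A function with non-zero derivative along a smooth curve has non-zero differential.**  If
`γ 0 = x`, `τ` is differentiable at `x`, `γ` at `0`, and `τ ∘ γ` has derivative `D ≠ 0` at `0`,
then `mfderiv τ x ≠ 0` (chain rule `d(τ ∘ γ) = dτ ∘ dγ`). [folklore] -/
theorem mfderiv_ne_zero_of_hasDerivAt_comp {τ : M → ℝ} {γ : ℝ → M} {x : M} {D : ℝ}
    (hγ0 : γ 0 = x) (hτ : MDifferentiableAt (𝓡 m) 𝓘(ℝ, ℝ) τ x)
    (hγ : MDifferentiableAt 𝓘(ℝ, ℝ) (𝓡 m) γ 0) (hD : HasDerivAt (τ ∘ γ) D 0) (hD0 : D ≠ 0) :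
    mfderiv (𝓡 m) 𝓘(ℝ, ℝ) τ x ≠ 0 := by
  intro h0
  have h1 : HasMFDerivAt (𝓡 m) 𝓘(ℝ, ℝ) τ x
      (0 : TangentSpace (𝓡 m) x →L[ℝ] TangentSpace 𝓘(ℝ, ℝ) (τ x)) := by
    have := hτ.hasMFDerivAt
    rwa [h0] at this
  subst hγ0
  have h2 : HasMFDerivAt 𝓘(ℝ, ℝ) 𝓘(ℝ, ℝ) (τ ∘ γ) 0
      ((0 : TangentSpace (𝓡 m) (γ 0) →L[ℝ] TangentSpace 𝓘(ℝ, ℝ) (τ (γ 0))).comp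
        (mfderiv 𝓘(ℝ, ℝ) (𝓡 m) γ 0)) :=
    h1.comp 0 hγ.hasMFDerivAt
  rw [ContinuousLinearMap.zero_comp] at h2
  have h3 : HasFDerivAt (τ ∘ γ) (0 : ℝ →L[ℝ] ℝ) 0 := hasMFDerivAt_iff_hasFDerivAt.1 h2
  have h4 : HasDerivAt (τ ∘ γ) 0 0 := by simpa using h3.hasDerivAt
  exact hD0 (hD.unique h4)

end ChainRule

/-! ### Registered sub-goal -/

/-- **Registered sub-goal (explicit binders, universe `0`)**: the local separating coordinate of
a two-sided smoothly embedded hypersurface and its coordinate line, `exists_local_sepFun`.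
[folklore] -/
theorem stub_pinch_sepFun_local :
    ∀ (n : ℕ) (S : Type) [TopologicalSpace S] [ChartedSpace (EuclideanSpace ℝ (Fin n)) S]
      (X : Type) [TopologicalSpace X] [ChartedSpace (EuclideanSpace ℝ (Fin (n + 1))) X]
      (f : S → X) (A B : Set X) (z₀ : S),
      Manifold.IsSmoothEmbedding (𝓡 n) (𝓡 (n + 1)) ∞ f → IsOpen A → IsOpen B → Disjoint A B →
      Set.range f = (A ∪ B)ᶜ → Set.range f ⊆ closure A → Set.range f ⊆ closure B →
      ∃ (O : Set X) (ψ : X → ℝ), IsOpen O ∧ f z₀ ∈ O ∧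
        ContMDiffOn (𝓡 (n + 1)) 𝓘(ℝ, ℝ) ∞ ψ O ∧ (∀ x ∈ O, x ∈ Set.range f ↔ ψ x = 0) ∧
        (∀ x ∈ O, x ∉ Set.range f → ((0 < ψ x ↔ x ∈ B) ∧ (ψ x < 0 ↔ x ∈ A))) ∧
        ∀ x ∈ O, x ∈ Set.range f → ∃ γ : ℝ → X, γ 0 = x ∧
          ContMDiffAt 𝓘(ℝ, ℝ) (𝓡 (n + 1)) ∞ γ 0 ∧
          Filter.Eventually (fun s : ℝ => γ s ∈ O ∧ ψ (γ s) = s) (nhds 0) :=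
  fun _ _ _ _ _ _ _ _ _ _ z₀ hf hA hB hAB hK hclA hclB =>
    exists_local_sepFun hf hA hB hAB hK hclA hclB z₀

end Summit.SmoothPoincare4.SmoothPoincare4.Theorems.OrigamiRung.PairRigidityEndgame

end
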